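import Literature.NumberTheory.EllipticCurves.ModularJacobianModTwoMultiplicityOne
import Literature.NumberTheory.EllipticCurves.NewformsHeckeProofs
import Literature.NumberTheory.EllipticCurves.ModularSymbolsLattice
import Mathlib.FieldTheory.Finiteness
import HarnessLib
import Summits.BirchSwinnertonDyer.BirchSwinnertonDyer.Theorems.ResidualThetaTransportAtTwoThetaLayerLambdaCongruenceAtTwoSocleOfCosocle
import Summits.BirchSwinnertonDyer.BirchSwinnertonDyer.Theorems.ResidualThetaTransportAtTwoSignedMuVanishingAtTwoPlusMultOneSocle
import Literature.NumberTheory.EllipticCurves.ModularJacobianTorsionHeckeSelfDual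


set_option autoImplicit false
set_option linter.dupNamespace false

noncomputable section

open scoped Classical MatrixGroups ModularForm NumberField

open CongruenceSubgroup Polynomial IsDedekindDomain Literature.NumberTheory.EllipticCurves
  Literature.NumberTheory.EllipticCurves.ModularForms Literature.NumberTheory.GaloisRepresentations Rat.HeightOneSpectrum

namespace Summit.BirchSwinnertonDyer.BirchSwinnertonDyer.Theorems.SignedMuAtTwo

namespace MultOneDictionary

variable {N : ℕ} [NeZero N]


set_option linter.unusedTactic false in
set_option linter.unreachableTactic false in
set_option linter.unusedVariables false in
/-- (TYPING-ROBUST twin of `card_le_four_of_multiplicityOne`, one extra binder `hSD`.) **At most four mod-`2` eigenvectors modulo `2Λ`**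
for the eigensystem of a newform `f` with integer eigenvalues, granted Buzzard's hypotheses at `𝔪_f` — proved so that it elaborates under
EITHER coordinate of the ONE vendored Buzzard fact (sub form today: first branch, `hSD` idle; cosocle/Picard form after a re-typing: second
branch through `…ThetaLayerLambdaCongruenceAtTwo.finrank_torsionBySet_eq_two_of_cosocle_of_sd`, p650638). Caller `card_eigenChar_le_four`
holds `hPair`, hence `hSD := heckeSelfDual_torsionBy_J0_of_perfectPairing hPair`. [cite: Buzzard2000LevelLoweringModTwo, Prop. 2.4 and Def. 2.1–2.2 (p. 100–101)]
[cite: DarmonDiamondTaylor1995, §1.6 Lemma 1.38] -/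
theorem card_le_four_of_multiplicityOne_of_sd (hSD : heckeSelfDual_torsionBy_J0)
    (hBuz : buzzard2000_multiplicityOne_gamma0) (hN : Odd N)
    (f : CuspForm (Gamma0 N) 2) (hf : IsNewform0 f) (A : ℕ → ℤ) (hA : ∀ p : ℕ, p.Prime → cuspCoeff f p = (A p : ℂ))
    (k : Type) [Field k] [IsAlgClosed k] [CharP k 2] [TopologicalSpace k] [DiscreteTopology k]
    (ρ : ModPGaloisRep ℚ k 2)
    (hρ : ∀ v : HeightOneSpectrum (𝓞 ℚ), ¬ ((primesEquiv v : Nat.Primes) : ℕ) ∣ 2 * N →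
      ρ.IsUnramifiedAt v ∧
        ρ.HasFrobCharpolyAt v
          (X ^ 2 - C (((A ((primesEquiv v : Nat.Primes) : ℕ) : ℤ) : k)) * X + C (((primesEquiv v : Nat.Primes) : ℕ) : k)))
    (hirr : FramedRep.IsIrreducible ρ)
    (h2 : ∀ v : HeightOneSpectrum (𝓞 ℚ), ((primesEquiv v : Nat.Primes) : ℕ) = 2 →
      ∀ 𝔓 ∈ v.primesAbove, ∃ σ ∈ 𝔓.decompositionSubgroup (Field.absoluteGaloisGroup ℚ),
        ∀ c : k, ((ρ σ : GL (Fin 2) k) : Matrix (Fin 2) (Fin 2) k) ≠ Matrix.scalar (Fin 2) c)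
    (s : Finset (Module.Dual ℂ (CuspForm (Gamma0 N) 2)))
    (hs : ∀ x ∈ s, x ∈ periodHomology N ∧ ∀ (p : ℕ) (hp : p.Prime), ∃ y ∈ periodHomology N,
      (haveI : NeZero p := ⟨hp.ne_zero⟩; heckeT (Gamma0 N) 2 p).dualMap x - ((A p : ℤ) : ℂ) • x = (2 : ℂ) • y)
    (hinc : ∀ x ∈ s, ∀ x' ∈ s, x ≠ x' → ¬ ∃ z ∈ periodHomology N, x - x' = (2 : ℂ) • z) :
    s.card ≤ 4 := by
  classical
  have hf0 : f ≠ 0 := hf.ne_zero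
  have hAT : ∀ (p : ℕ) (hp : p.Prime), (haveI : NeZero p := ⟨hp.ne_zero⟩; heckeT (Gamma0 N) 2 p) f = ((A p : ℤ) : ℂ) • f := by
    intro p hp
    haveI : NeZero p := ⟨hp.ne_zero⟩
    rw [IsNewform0.heckeT_eq_coeff_smul hf hp]
    change cuspCoeff f p • f = _
    rw [hA p hp]
  -- Step 1: the eigenvalue character `ev : 𝕋_ℤ → ℤ`
  have huniq : ∀ m n : ℤ, (m : ℂ) • f = (n : ℂ) • f → m = n := by
    intro m n h
    have h' : ((m : ℂ) - n) • f = 0 := by rw [sub_smul, h, sub_self]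
    rcases smul_eq_zero.mp h' with h1 | h1
    · exact_mod_cast sub_eq_zero.mp h1
    · exact absurd h1 hf0
  have hex : ∀ t : HeckeRing0 N 2, ∃ n : ℤ, HeckeRing0.toEnd N 2 t f = (n : ℂ) • f := by
    intro t
    obtain ⟨n, hn, -⟩ := exists_eigenvalue_and_sub_mem_two f A hAT (x := 0)
      (fun p hp ↦ ⟨0, (periodHomology N).zero_mem, by simp⟩) (HeckeRing0.toEnd_mem N 2 t)
    exact ⟨n, hn⟩
  choose ev hev using hex
  have hev_spec : ∀ (t : HeckeRing0 N 2) (n : ℤ), HeckeRing0.toEnd N 2 t f = (n : ℂ) • f → ev t = n :=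
    fun t n hn ↦ huniq _ _ ((hev t).symm.trans hn)
  have hev1 : ev 1 = 1 := hev_spec 1 1 (by rw [map_one, Module.End.one_apply, Int.cast_one, one_smul])
  have hevmul : ∀ t u : HeckeRing0 N 2, ev (t * u) = ev t * ev u := by
    intro t u
    apply hev_spec
    rw [map_mul, Module.End.mul_apply, hev u, LinearMap.map_smul, hev t, smul_smul, Int.cast_mul, mul_comm]
  have hevadd : ∀ t u : HeckeRing0 N 2, ev (t + u) = ev t + ev u := by
    intro t u
    apply hev_spec
    rw [map_add, LinearMap.add_apply, hev t, hev u, Int.cast_add, add_smul]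
  have hev0 : ev 0 = 0 := hev_spec 0 0 (by rw [map_zero, LinearMap.zero_apply, Int.cast_zero, zero_smul])
  have hevT : ∀ (p : ℕ) (hp : p.Prime), ev (HeckeRing0.T N 2 p hp) = A p := by
    intro p hp
    apply hev_spec
    rw [HeckeRing0.toEnd_T]
    exact hAT p hp
  let evHom : HeckeRing0 N 2 →+* ℤ :=
    { toFun := ev, map_one' := hev1, map_mul' := hevmul, map_zero' := hev0, map_add' := hevadd }
  -- Step 2: `𝔪_f = ker (ev mod 2)`, maximal, `𝕋/𝔪_f = 𝔽₂ ↪ k`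
  let lam : HeckeRing0 N 2 →+* ZMod 2 := (Int.castRingHom (ZMod 2)).comp evHom
  have hlam : ∀ t, lam t = ((ev t : ℤ) : ZMod 2) := fun t ↦ rfl
  have hlam_surj : Function.Surjective lam := by
    intro c
    fin_cases c
    · exact ⟨0, by rw [map_zero]; rfl⟩
    · exact ⟨1, by rw [map_one]; rfl⟩
  set 𝔪 : Ideal (HeckeRing0 N 2) := RingHom.ker lam with h𝔪def
  haveI h𝔪max : 𝔪.IsMaximal := RingHom.ker_isMaximal_of_surjective lam hlam_surj
  have h2mem : (2 : HeckeRing0 N 2) ∈ 𝔪 := by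
    rw [h𝔪def, RingHom.mem_ker, map_ofNat]
    rfl
  have h2mem' : ((2 : ℕ) : HeckeRing0 N 2) ∈ 𝔪 := by rw [Nat.cast_ofNat]; exact h2mem
  let ι : HeckeRing0 N 2 ⧸ 𝔪 →+* k :=
    Ideal.Quotient.lift 𝔪 ((ZMod.castHom (dvd_refl 2) k).comp lam) fun t ht ↦ by
      rw [h𝔪def, RingHom.mem_ker] at ht
      rw [RingHom.comp_apply, ht, map_zero]
  have hιT : ∀ (p : ℕ) (hp : p.Prime), ι (Ideal.Quotient.mk 𝔪 (HeckeRing0.T N 2 p hp)) = ((A p : ℤ) : k) := by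
    intro p hp
    simp only [ι, Ideal.Quotient.lift_mk, RingHom.comp_apply, hlam, hevT p hp, ZMod.castHom_apply]
    exact ZMod.cast_intCast (dvd_refl 2) (A p)
  -- Step 3: Buzzard 2000 Prop. 2.4 at `𝔪_f` — in EITHER coordinate (sub form today; cosocle form under the Picard typing, via SD)
  have hcardK : Nat.card (HeckeRing0 N 2 ⧸ 𝔪) = 2 := by
    rw [h𝔪def, Nat.card_congr (RingHom.quotientKerEquivOfSurjective hlam_surj).toEquiv, Nat.card_zmod]
  have hU : ∀ v : HeightOneSpectrum (𝓞 ℚ), ¬ ((primesEquiv v : Nat.Primes) : ℕ) ∣ 2 * N →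
      ρ.IsUnramifiedAt v ∧
        ρ.HasFrobCharpolyAt v
          (X ^ 2
            - C (ι (Ideal.Quotient.mk 𝔪 (HeckeRing0.T N 2
                ((primesEquiv v : Nat.Primes) : ℕ) (primesEquiv v : Nat.Primes).2))) * X
            + C (((primesEquiv v : Nat.Primes) : ℕ) : k)) := by
    intro v hv
    obtain ⟨hur, hchar⟩ := hρ v hv
    refine ⟨hur, ?_⟩
    rw [hιT]
    exact hchar
  have hdim : Module.finrank (HeckeRing0 N 2 ⧸ 𝔪) (Submodule.torsionBySet (HeckeRing0 N 2) (J0 N) 𝔪) = 2 := by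
    first
      | exact hBuz N hN 𝔪 h𝔪max h2mem k ι ρ hU hirr h2
      | exact Summit.BirchSwinnertonDyer.BirchSwinnertonDyer.Theorems.ThetaLayerLambdaCongruenceAtTwo.finrank_torsionBySet_eq_two_of_cosocle_of_sd
          hSD 𝔪 h2mem hcardK (hBuz N hN 𝔪 h𝔪max h2mem k ι ρ hU hirr h2)
  -- Step 4: `#J₀(N)[𝔪_f] = 4`
  letI : Field (HeckeRing0 N 2 ⧸ 𝔪) := Ideal.Quotient.field 𝔪
  haveI hfin : Finite (Submodule.torsionBySet (HeckeRing0 N 2) (J0 N) 𝔪) := J0.finite_torsionBySet N two_ne_zero h2mem'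
  haveI : Module.Finite (HeckeRing0 N 2 ⧸ 𝔪) (Submodule.torsionBySet (HeckeRing0 N 2) (J0 N) 𝔪) :=
    Module.Finite.of_finite
  have hcard4 : Nat.card (Submodule.torsionBySet (HeckeRing0 N 2) (J0 N) 𝔪) = 4 := by
    rw [Module.natCard_eq_pow_finrank (K := HeckeRing0 N 2 ⧸ 𝔪), hcardK, hdim]
    norm_num
  -- Step 5: mod-2 eigenvectors land in `J₀(N)[𝔪_f]` under `x ↦ [½ x]`
  have hsmul_mem : ∀ x ∈ s, ∀ t ∈ 𝔪, ∃ w ∈ periodHomology N, t • x = (2 : ℂ) • w := by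
    intro x hx t ht
    obtain ⟨hxΛ, hsoc⟩ := hs x hx
    obtain ⟨n, hn, y, hy, hyt⟩ := exists_eigenvalue_and_sub_mem_two f A hAT hsoc (HeckeRing0.toEnd_mem N 2 t)
    have hn' : ev t = n := hev_spec t n hn
    have h2n : (2 : ℤ) ∣ n := by
      rw [h𝔪def, RingHom.mem_ker, hlam, hn'] at ht
      exact (ZMod.intCast_zmod_eq_zero_iff_dvd n 2).mp ht
    obtain ⟨m, rfl⟩ := h2n
    refine ⟨(m : ℂ) • x + y, add_mem ?_ hy, ?_⟩
    · rw [Int.cast_smul_eq_zsmul]; exact (periodHomology N).zsmul_mem hxΛ m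
    · have htx : t • x = (HeckeRing0.toEnd N 2 t).dualMap x := rfl
      rw [htx, smul_add, smul_smul, ← hyt, Int.cast_mul, Int.cast_ofNat]
      abel
  have hmemT : ∀ x (hx : x ∈ s),
      J0.divMap N 2 ⟨x, (hs x hx).1⟩ ∈ Submodule.torsionBySet (HeckeRing0 N 2) (J0 N) 𝔪 := by
    intro x hx
    rw [Submodule.mem_torsionBySet_iff]
    rintro ⟨t, ht⟩
    obtain ⟨w, hw, htw⟩ := hsmul_mem x hx t ht
    change t • Submodule.Quotient.mk ((2 : ℂ)⁻¹ • x) = (0 : J0 N)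
    rw [← Submodule.Quotient.mk_smul, hecke_smul_complex_smul, htw, smul_smul, inv_mul_cancel₀ two_ne_zero, one_smul,
      Submodule.Quotient.mk_eq_zero]
    exact hw
  -- Step 6: the map `s → J₀(N)[𝔪_f]` is injective (classes are incongruent mod `2Λ`)
  let g : s → Submodule.torsionBySet (HeckeRing0 N 2) (J0 N) 𝔪 := fun x ↦ ⟨J0.divMap N 2 ⟨x.1, (hs x.1 x.2).1⟩, hmemT x.1 x.2⟩
  have hg : Function.Injective g := by
    rintro ⟨x, hx⟩ ⟨x', hx'⟩ h
    have h' : J0.divMap N 2 ⟨x, (hs x hx).1⟩ = J0.divMap N 2 ⟨x', (hs x' hx').1⟩ := congrArg Subtype.val h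
    change Submodule.Quotient.mk ((2 : ℂ)⁻¹ • x) = Submodule.Quotient.mk ((2 : ℂ)⁻¹ • x') at h'
    rw [Submodule.Quotient.eq, mem_periodHomologyHecke] at h'
    by_contra hne
    have hne' : x ≠ x' := fun e ↦ hne (Subtype.ext e)
    refine hinc x hx x' hx' hne' ⟨(2 : ℂ)⁻¹ • x - (2 : ℂ)⁻¹ • x', h', ?_⟩
    rw [smul_sub, smul_smul, mul_inv_cancel₀ two_ne_zero, one_smul, smul_smul, mul_inv_cancel₀ two_ne_zero, one_smul]
  -- Step 7: count
  calc s.card = Nat.card s := (Nat.card_eq_finsetCard s).symm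
    _ ≤ Nat.card (Submodule.torsionBySet (HeckeRing0 N 2) (J0 N) 𝔪) := Nat.card_le_card_of_injective g hg
    _ = 4 := hcard4

end MultOneDictionary

end Summit.BirchSwinnertonDyer.BirchSwinnertonDyer.Theorems.SignedMuAtTwo

end
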